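import Summits.BirchSwinnertonDyer.Rank1Residual.Additive.RankOneTamagawaParity
import Summits.BirchSwinnertonDyer.Rank1Residual.X11b.BDPRouteManin
import Literature.NumberTheory.EllipticCurves.Rank1Residual.Typed.X6
import Literature.NumberTheory.EllipticCurves.Rank1Residual.Typed.X7
import HarnessLib

/-!
# Classes X7 and X6, analytic rank `1`, good supersingular `p ≥ 5` with `ord_p ∏c_ℓ = 1`: `BSD(E,p)` per
# pair from ONE Kurihara number non-zero MODULO `p²` at a level-two Kolyvagin prime (Kim, Amer. J. Math.
# 2026, Thm. 1.8 (6)) + Cassels–Tate — the supersingular-family readings of the cell's level-two consumer,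
# with the Manin-unit parametrisation datum DISCHARGED at a good prime (cell `b2b-bsdres`, prover A =
# unit `b2b-bsdres-x10b`, gen 6; X7 joint with prover B = `b2b-bsdres-additive-p3`)

HONEST FRAMING (run/shared/lean/b2b/bsd-rank1-residual/, verbatim in every file): the goal of the
cell is to DELETE the COMBINATION-SHAPED residual classes of the Birch–Swinnerton-Dyer formula for
ALL analytic-rank `≤ 1` elliptic curves over `ℚ` — "full BSD formula for every rank `≤ 1` curve in
class `C`" assembled STRICTLY from published theorems — so that the rank-`≤ 1` remainder becomes
exactly the CONSTRUCTION-SHAPED classes, which are TYPED (missing-input `Prop`s), NOT attempted.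
This is not "finishing BSD". THEOREMS ONLY; per pair; NOT a class theorem; X6 and X7 stay
CONSTRUCTION-SHAPED; nothing is booked here (the lane books pairs: two engines + referee).

## What this file does (hyp GEN 18 KIM-P2, `HOME/b2b-bsdres-hyp/hyp/kimp2/KIM-P2.md`; X7-KURIHARA.md §3)

At a rank-one pair with `p ∣ ∏c_ℓ` a UNIT mod-`p` Kurihara number cannot exist (Kim Conj. 1.10:
`∂^(∞)(δ̃) = Σ_ℓ ord_p c_ℓ`), so the mod-`p` route of `X7KuriharaRoute.lean` (p218800) is void there. When
`ord_p ∏c_ℓ = 1` exactly, the tree's LEVEL-TWO instrument applies: the harvest-2 seat's class-agnostic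
consumer `bsdp_of_kim_rankOne_levelTwo_of_casselsTate` (`Additive/RankOneTamagawaParity.lean`, p202668)
of the named fact `Kim2022_rankOne_padicValNat_sha_le_one_of_kuriharaNumber_levelTwo_ne_zero_of_maninConstant`
(Kim 2026 Thm. 1.8 (6) at a level-two prime: ONE `δ̃_ℓ ≢ 0 (mod p²)` at `ℓ ∈ 𝒫_2` — `ℓ ∤ Np`, `ℓ ≡ 1`,
`a_ℓ ≡ ℓ + 1 (mod p²)` — with cyclic `p`-part ⇒ `ord_p #Ш ≤ 1`; Cassels–Tate ⇒ `#Ш` is a square ⇒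
`ord_p #Ш = 0`; with the lane's unit `#Ш_an` ⇒ `BSD(E,p)`). That consumer displays a Manin binder
`p ∤ c_D` for the parametrisation datum `D` whose newform carries the certificate. AT A GOOD PRIME this
binder is DISCHARGED in the kernel: `p ∤ N_E` (good reduction), so `p² ∤ N_E`, and x11b's
`X11b.exists_modularParametrizationData_not_dvd` (`X11b/BDPRouteManin.lean`, p203629: the `X₀(N)`-optimal
curve of the isogeny class by modularity `hnf`, Mazur 1978 Cor. 4.1 `hMaz` at an odd `p` with `p² ∤ N`,
a prime-to-`p` isogeny to `W` since `E[p]` is irreducible, and the Néron mapping property `hNS`) produces a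
datum `D` of `W` at level `N_E` with `p ∤ c_D`; its newform is THE newform of `W` (`IsNewformOf.unique`,
`q`-expansion principle), so the certificate stated for any newform `f` of `W` at level `N_E` transports.

* `X7.bsdp_of_kim_rankOne_levelTwo_of_casselsTate` — X7 ∧ `r_an = 1` ∧ `p ≥ 5` ∧ surj(p) ∧ `#Ш_an = q`,
  `ord_p q = 0` + ONE `δ̃_ℓ ≢ 0 (mod p²)` at a level-two Kolyvagin prime with cyclic `p`-part ⇒ `BSDp W p`.
  Named inputs, all PUBLISHED: Kim Thm. 1.8 (6) level two (`hKim2`), the period transfer (`hϖ`),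
  Cassels–Tate (`hCT`), GZK (`hGZK`), modularity (`hmod`, `hnf`), Mazur Cor. 4.1 (`hMaz`), Néron mapping
  property (`hNS`). NO Manin binder, no `p ∤ ∏c_ℓ`.
* `X6.bsdp_of_kim_rankOne_levelTwo_of_casselsTate` — the same on X6 (surj automatic, `ClassX6.surj`).

Where it bites (KIM-P2, CORE of record, `N < 2·10⁴`): the 10 X7 ∧ `r = 1` pairs at a good supersingular
`p ≥ 5` with `ord_p ∏c_ℓ = 1` — 7644h1@5 (`ℓ = 2851`, `δ̃ ≡ 15 mod 25`), 11676d1@5 (`11701`, `15`),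
12350p1@11 (`89057`, `99 mod 121`), 15162bb1@11 (`74779`, `22`), 17514m1@5 (`5501`, `5`), 18126q1@11
(`468271`, `11`), 19665h1@7 (`11467`, `28 mod 49`), 18768d1@5 (`1201`, `10`), 19536z1@5 (`10601`, `10`),
19860j1@7 (`30577`, `35`) — impl 1 (exact symbol tables folded mod `p²`) 39/39 levels, impl 2 (native
`k = 2`) 27/39, identical where both ran, 0 disagreements (hyp kit j095574, j095600–2, j095977–9, j096952).
NOT served: ord_p ∏c_ℓ ≥ 2 (7728t1@5, 14352bh1@5: no Kurihara route in the tree).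

References: Kim 2026 [Kim2022StructureSelmer] Thm. 1.8 (6), §1.2.2, §1.3.5; Mazur 1978 Cor. 4.1
[Mazur1978]; Greenberg–Vatsal 2000 Rem. 3.4 [GreenbergVatsal2000]; Silverman ATAEC IV.5.1
[SilvermanATAEC1994]; Silverman AEC X.4.14 (Cassels–Tate) [SilvermanAEC2009]; Serre 1972 Props. 12, 21
[Serre1972]; Diamond–Shurman Thm. 8.8.3 [DiamondShurman2005]; Miller 2011 Def. 1.1 [Miller2011LMS].
-/

set_option autoImplicit false

noncomputable section

open scoped Classical MatrixGroups ModularForm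

open CongruenceSubgroup WeierstrassCurve Literature.NumberTheory.EllipticCurves
  Literature.NumberTheory.EllipticCurves.ModularForms
  Literature.NumberTheory.EllipticCurves.Rank1Residual
  Literature.NumberTheory.EllipticCurves.Rank1Residual.Typed

namespace Summit.BirchSwinnertonDyer.Rank1Residual.Supersingular

variable (W : WeierstrassCurve ℚ) [W.IsElliptic] [W.IsGloballyMinimal] (p : ℕ) [Fact p.Prime]

/-- **The level-two Kurihara route at a GOOD prime `p ≥ 5` with `E[p]` irreducible, Manin binder
discharged.** For a globally minimal `W` with good reduction at `p ≥ 5`, `E[p]` irreducible, `ρ̄_{E,p}`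
onto, analytic rank `1`, the lane's `#Ш_an = q` with `ord_p q = 0`, the newform `f` of `W` at level
`N = N_E`, and ONE `δ̃_ℓ ≢ 0 (mod p²)` at a level-two Kolyvagin prime `ℓ` with cyclic `p`-part: `BSDp W p`.
The Manin-unit datum `D` (`p ∤ c_D`) is produced by `X11b.exists_modularParametrizationData_not_dvd`
(modularity `hnf`, Mazur Cor. 4.1 `hMaz` — `p` odd, `p² ∤ N_E` since `p ∤ N_E` — prime-to-`p` isogeny by
irreducibility, Néron mapping property `hNS`), `D.f = f` by `IsNewformOf.unique`, the period transfer for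
`D.f` is `hϖ` (Greenberg–Vatsal Rem. 3.4 + Mazur Cor. 4.1, good `p ≥ 5`, irreducible), and the rest is
the harvest-2 consumer `bsdp_of_kim_rankOne_levelTwo_of_casselsTate` (Kim Thm. 1.8 (6) level two `hKim2`
+ Cassels–Tate `hCT` + GZK). Per pair; class-agnostic; NOT a class theorem.
[cite: Kim2022StructureSelmer, Thm. 1.9 (6) (PDF p. 8), §1.2.2 (PDF p. 5), §1.3.5] [cite: Mazur1978, Cor. 4.1]
[cite: GreenbergVatsal2000, §3, Remark 3.4] [cite: SilvermanAEC2009, Thm. X.4.14] [cite: Miller2011LMS, Def. 1.1] -/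
theorem bsdp_of_kim_rankOne_levelTwo_of_casselsTate_of_good
    (hKim2 : Kim2022_rankOne_padicValNat_sha_le_one_of_kuriharaNumber_levelTwo_ne_zero_of_maninConstant)
    (hϖ : realPeriodRat_eq_unit_mul_plusPeriod)
    (hCT : exists_casselsTate_pairing (K := ℚ))
    (hGZK : rank_eq_analyticRank_of_analyticRank_le_one) (hmod : hasEntireLFunction_rat)
    (hnf : exists_isNewformOf) (hMaz : mazur_not_dvd_maninConstant_of_odd)
    (hNS : integral_neronScaling_of_isGloballyMinimal)
    (hp : 5 ≤ p) (hgood : W.HasGoodReductionAtPrime p) (hirr : Irr W p) (hsurj : Surj W p)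
    (hr : W.analyticRank = 1) {q : ℚ} (hq : shaAn W = (q : ℂ)) (hv : padicValRat p q = 0)
    {N : ℕ} [NeZero N] (hN : W.conductorNorm ℤ = N) (f : CuspForm (Gamma0 N) 2) (hf : IsNewformOf W f)
    (ℓ : ℕ) [Fact ℓ.Prime] (hℓ : Kato.IsKolyvaginPrime W p 2 ℓ)
    (hcyc : Nat.card {P : ((WeierstrassCurve.integralModelInt W).map
        (Int.castRingHom (ZMod ℓ))).toAffine.Point // p • P = 0} ≤ p)
    (ψ : (ℓ' : ℕ) → (ZMod ℓ')ˣ →* Multiplicative (ZMod (p ^ 2)))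
    (hψ : Function.Surjective (ψ ℓ)) (hδ : kuriharaNumber f (p ^ 2) ℓ ψ ≠ 0) : BSDp W p := by
  have hP : p.Prime := Fact.out
  have hp2 : p ≠ 2 := by omega
  have hpN : ¬ p ^ 2 ∣ N := by
    intro h
    exact not_dvd_level_of_isNewformOf hf hgood (dvd_trans (dvd_pow_self p two_ne_zero) h)
  obtain ⟨D, hc⟩ := X11b.exists_modularParametrizationData_not_dvd hnf hMaz hNS W hN hP hp2 hpN hirr
  have hfD : D.f = f := IsNewformOf.unique D.isNewformOf hf
  have hδ' : kuriharaNumber D.f (p ^ 2) ℓ ψ ≠ 0 := by rw [hfD]; exact hδ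
  exact bsdp_of_kim_rankOne_levelTwo_of_casselsTate W p hKim2 hCT hGZK hmod hp hsurj hr hq hv D hc
    (hϖ W p hp hgood hirr D.f D.isNewformOf) ℓ hℓ hcyc ψ hψ hδ'

/-- **X7 ∧ `r_an = 1` ∧ `p ≥ 5` ∧ surj(p) ∧ `ord_p #Ш_an = 0`: `BSD(E,p)` from PUBLISHED theorems plus
ONE Kurihara number non-zero MODULO `p²` at a level-two Kolyvagin prime** — the route for the X7 rank-one
pairs with `ord_p ∏c_ℓ = 1` (where no unit `δ̃ mod p` exists). On class X7 (good supersingular at `p`,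
`E` not semistable): good reduction (class) and irreducibility (`ClassX7.irr`, Serre Prop. 12) are
automatic, surjectivity is per pair (`hsurj`); the Manin binder of the level-two consumer is DISCHARGED
at the good prime (`bsdp_of_kim_rankOne_levelTwo_of_casselsTate_of_good`). Inputs by name: Kim Thm. 1.8
(6) level two (`hKim2`), period transfer (`hϖ`), Cassels–Tate (`hCT`), GZK (`hGZK`), modularity (`hmod`,
`hnf`), Mazur Cor. 4.1 (`hMaz`), Néron mapping property (`hNS`); per pair: `#Ш_an = q` unit, the newform
`f` at level `N_E`, `ℓ ∈ 𝒫_2` with cyclic `p`-part, `ψ_ℓ ↠ ℤ/p²`, `δ̃_ℓ ≢ 0 (mod p²)`. Per pair; NOT a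
class theorem; X7 stays CONSTRUCTION-SHAPED.
[cite: Kim2022StructureSelmer, Thm. 1.9 (6) (PDF p. 8), §1.2.2 (PDF p. 5), §1.3.5] [cite: Mazur1978, Cor. 4.1]
[cite: Serre1972, §1.11 Prop. 12] [cite: SilvermanAEC2009, Thm. X.4.14] [cite: Miller2011LMS, Def. 1.1] -/
theorem X7.bsdp_of_kim_rankOne_levelTwo_of_casselsTate
    (hKim2 : Kim2022_rankOne_padicValNat_sha_le_one_of_kuriharaNumber_levelTwo_ne_zero_of_maninConstant)
    (hϖ : realPeriodRat_eq_unit_mul_plusPeriod)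
    (hCT : exists_casselsTate_pairing (K := ℚ))
    (hGZK : rank_eq_analyticRank_of_analyticRank_le_one) (hmod : hasEntireLFunction_rat)
    (hnf : exists_isNewformOf) (hMaz : mazur_not_dvd_maninConstant_of_odd)
    (hNS : integral_neronScaling_of_isGloballyMinimal)
    (hp : 5 ≤ p) (hX : ClassX7 W p) (hsurj : Surj W p) (hr : W.analyticRank = 1)
    {q : ℚ} (hq : shaAn W = (q : ℂ)) (hv : padicValRat p q = 0)
    {N : ℕ} [NeZero N] (hN : W.conductorNorm ℤ = N) (f : CuspForm (Gamma0 N) 2) (hf : IsNewformOf W f)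
    (ℓ : ℕ) [Fact ℓ.Prime] (hℓ : Kato.IsKolyvaginPrime W p 2 ℓ)
    (hcyc : Nat.card {P : ((WeierstrassCurve.integralModelInt W).map
        (Int.castRingHom (ZMod ℓ))).toAffine.Point // p • P = 0} ≤ p)
    (ψ : (ℓ' : ℕ) → (ZMod ℓ')ˣ →* Multiplicative (ZMod (p ^ 2)))
    (hψ : Function.Surjective (ψ ℓ)) (hδ : kuriharaNumber f (p ^ 2) ℓ ψ ≠ 0) : BSDp W p :=
  bsdp_of_kim_rankOne_levelTwo_of_casselsTate_of_good W p hKim2 hϖ hCT hGZK hmod hnf hMaz hNS hp hX.1.1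
    (ClassX7.irr W p (by omega) hX) hsurj hr hq hv hN f hf ℓ hℓ hcyc ψ hψ hδ

/-- **X6 ∧ `r_an = 1` ∧ `p ≥ 5` ∧ `ord_p #Ш_an = 0`: `BSD(E,p)` from PUBLISHED theorems plus ONE Kurihara
number non-zero MODULO `p²` at a level-two Kolyvagin prime** — the X6 twin (good supersingular,
semistable, `p ≥ 5 ∨ a_3 = 0`): good reduction, irreducibility AND surjectivity (`ClassX6.surj`, Serre
Props. 12 + 21 i)) are automatic; Manin binder discharged at the good prime. Same named inputs as
`X7.bsdp_of_kim_rankOne_levelTwo_of_casselsTate`. For the X6 rank-one pairs with `ord_p ∏c_ℓ = 1`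
(semistable: `c_ℓ = ord_ℓ Δ` at split `ℓ`). Per pair; NOT a class theorem; X6 stays CONSTRUCTION-SHAPED.
[cite: Kim2022StructureSelmer, Thm. 1.9 (6) (PDF p. 8), §1.2.2 (PDF p. 5), §1.3.5] [cite: Mazur1978, Cor. 4.1]
[cite: Serre1972, §5.4 Prop. 21 i)] [cite: SilvermanAEC2009, Thm. X.4.14] [cite: Miller2011LMS, Def. 1.1] -/
theorem X6.bsdp_of_kim_rankOne_levelTwo_of_casselsTate
    (hKim2 : Kim2022_rankOne_padicValNat_sha_le_one_of_kuriharaNumber_levelTwo_ne_zero_of_maninConstant)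
    (hϖ : realPeriodRat_eq_unit_mul_plusPeriod)
    (hCT : exists_casselsTate_pairing (K := ℚ))
    (hGZK : rank_eq_analyticRank_of_analyticRank_le_one) (hmod : hasEntireLFunction_rat)
    (hnf : exists_isNewformOf) (hMaz : mazur_not_dvd_maninConstant_of_odd)
    (hNS : integral_neronScaling_of_isGloballyMinimal)
    (hp : 5 ≤ p) (hX : ClassX6 W p) (hr : W.analyticRank = 1)
    {q : ℚ} (hq : shaAn W = (q : ℂ)) (hv : padicValRat p q = 0)
    {N : ℕ} [NeZero N] (hN : W.conductorNorm ℤ = N) (f : CuspForm (Gamma0 N) 2) (hf : IsNewformOf W f)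
    (ℓ : ℕ) [Fact ℓ.Prime] (hℓ : Kato.IsKolyvaginPrime W p 2 ℓ)
    (hcyc : Nat.card {P : ((WeierstrassCurve.integralModelInt W).map
        (Int.castRingHom (ZMod ℓ))).toAffine.Point // p • P = 0} ≤ p)
    (ψ : (ℓ' : ℕ) → (ZMod ℓ')ˣ →* Multiplicative (ZMod (p ^ 2)))
    (hψ : Function.Surjective (ψ ℓ)) (hδ : kuriharaNumber f (p ^ 2) ℓ ψ ≠ 0) : BSDp W p :=
  bsdp_of_kim_rankOne_levelTwo_of_casselsTate_of_good W p hKim2 hϖ hCT hGZK hmod hnf hMaz hNS hp hX.1.1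
    (ClassX6.irr W p (by omega) hX) (ClassX6.surj W p (by omega) hX) hr hq hv hN f hf ℓ hℓ hcyc ψ hψ hδ

end Summit.BirchSwinnertonDyer.Rank1Residual.Supersingular

end
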